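import Mathlib.Topology.Algebra.Group.OpenMapping
import Mathlib.Topology.Baire.LocallyCompactRegular
import Literature.AnabelianGeometry.AbsoluteAnabelian.ProfiniteAutGroupGlue
import HarnessLib

/-!
# The outer semi-direct product `G ⋊^out J` of profinite groups as a profinite group ([SemiAnbd] §0 p. 5; [AbsTopII] Def 1.2 (ii))

Mochizuki, *Semi-graphs of anabelioids*, Publ. RIMS **42** (2006), §0 p. 5 [cite: MochizukiSemiAnbd2006, §0 p.5]
("we shall denote by `G ⋊^out J` the outer semi-direct product of `J` with `G`, i.e., the fiber product
of `Aut(G) → Out(G)` and `J → Out(G)` … a natural exact sequence `1 → G → G ⋊^out J → J → 1`"), as used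
in [AbsTopII] Def 1.2 (ii) p. 10 (`Π_H := Π_𝔾 ⋊^out H`, `H → Out(Π_𝔾)` continuous, `Π_𝔾` topologically
finitely generated and centre-free).

PROFINITE PACKAGING (abc-iut cell, GAP row «G-P13-GR», file F3 of abc-iut-w5-d151 g4; consumer
abc-iut-w5-d226's `DPSCData.PiH`).  Over `ProfiniteAutGroup{,Glue}.lean` (`profiniteAut hG ≃ Aut(G)`,
`conjProfiniteAut : G →ₜ* profiniteAut hG` with closed normal image):

* `totallyDisconnectedSpace_quotient_of_isClosed` — a quotient of a profinite group by a CLOSED normal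
  subgroup is totally disconnected (closed subgroups are intersections of open ones);
* **`outProfinite hG : ProfiniteGrp`** = `profiniteAut hG ⧸ Inn(G)` = `Out(G)` as a profinite group, with
  the continuous surjection `outProj hG : profiniteAut hG →ₜ* outProfinite hG`;
* for a profinite `J` and a CONTINUOUS `θ : J →ₜ* outProfinite hG` (the continuous outer action):
  **`outerSemidirectProfinite hG θ : ProfiniteGrp`** = the closed subgroup `{(a, j) | outProj a = θ j}` of
  `profiniteAut hG × J` (an `eqLocus`, closed since `Out(G)` is Hausdorff);
* the topological exact sequence: `inlProfinite : G →ₜ* G ⋊^out J` continuous, injective for centre-free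
  `G` (`inlProfinite_injective`), with range = kernel of the continuous SURJECTIVE projection
  `sndProfinite : G ⋊^out J →ₜ* J` (`range_inlProfinite_eq_ker`, `sndProfinite_surjective`), and closed
  (`isClosed_range_inlProfinite`).

All topologies live inside `ProfiniteGrp` terms (local instances only); no instance is declared.  Nothing
here bears on [IUTchIII] Cor. 3.12.
-/

namespace Literature.AnabelianGeometry.AbsoluteAnabelian

open Literature.AnabelianGeometry.EtaleTheta Literature.AnabelianGeometry.SemiGraphs
open Filter Topology
open scoped Pointwise

universe u

/-! ### Quotients of profinite groups by closed normal subgroups are profinite -/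

section Quotient

variable {P : Type u} [Group P] [TopologicalSpace P] [IsTopologicalGroup P] [CompactSpace P]
  [TotallyDisconnectedSpace P]

/-- **A quotient of a profinite group by a closed normal subgroup is totally disconnected**: two distinct
cosets `xN ≠ yN` are separated by the clopen image of `x·U` for an OPEN subgroup `U ⊇ N` missing
`x⁻¹ y` (closed subgroups of profinite groups are intersections of open subgroups,
`ProfiniteGrp.closedSubgroup_eq_sInf_open`). [cite: MochizukiSemiAnbd2006, §0 p.5] -/
theorem totallyDisconnectedSpace_quotient_of_isClosed (N : Subgroup P) [N.Normal]
    (hN : IsClosed (N : Set P)) : TotallyDisconnectedSpace (P ⧸ N) := by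
  -- it suffices to be totally separated
  haveI : TotallySeparatedSpace (P ⧸ N) := by
    refine totallySeparatedSpace_iff_exists_isClopen.mpr fun x y hxy => ?_
    induction x using QuotientGroup.induction_on with
    | H x =>
    induction y using QuotientGroup.induction_on with
    | H y =>
    -- `x⁻¹ y ∉ N`, so some open subgroup `U ⊇ N` misses it
    have hxy' : x⁻¹ * y ∉ N := fun h => hxy (QuotientGroup.eq.mpr h)
    have hsInf := ProfiniteGrp.closedSubgroup_eq_sInf_open ⟨N, hN⟩
    have : ∃ U : Subgroup P, IsOpen (U : Set P) ∧ N ≤ U ∧ x⁻¹ * y ∉ U := by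
      by_contra h
      push Not at h
      apply hxy'
      have hmem : x⁻¹ * y ∈ sInf {U : Subgroup P | IsOpen (U : Set P) ∧ (⟨N, hN⟩ : ClosedSubgroup P) ≤ U} :=
        Subgroup.mem_sInf.mpr fun U hU => h U hU.1 hU.2
      rw [← hsInf] at hmem
      exact hmem
    obtain ⟨U, hUo, hNU, hxyU⟩ := this
    -- the image of the coset `x·U` is clopen (saturated closed, and open), contains `x̄`, misses `ȳ`
    have hsat : QuotientGroup.mk ⁻¹' (QuotientGroup.mk '' (x • (U : Set P)) : Set (P ⧸ N)) =
        x • (U : Set P) := by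
      ext z
      constructor
      · rintro ⟨w, ⟨u, hu, rfl⟩, hwz⟩
        have hwz' : (x • u)⁻¹ * z ∈ N := QuotientGroup.eq.mp hwz
        refine ⟨u * ((x • u)⁻¹ * z), U.mul_mem hu (hNU hwz'), ?_⟩
        simp only [smul_eq_mul]
        group
      · intro hz
        exact ⟨z, hz, rfl⟩
    refine ⟨QuotientGroup.mk '' (x • (U : Set P)), ⟨?_, ?_⟩, ⟨x, ⟨1, U.one_mem, mul_one x⟩, rfl⟩, ?_⟩
    · -- closed
      refine (QuotientGroup.isQuotientMap_mk N).isClosed_preimage.mp ?_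
      rw [hsat]
      exact ((U.isClosed_of_isOpen hUo).smul x)
    · exact QuotientGroup.isOpenMap_coe _ (hUo.smul x)
    · rintro ⟨w, ⟨u, hu, rfl⟩, hwy⟩
      apply hxyU
      have h : (x • u)⁻¹ * y ∈ N := QuotientGroup.eq.mp hwy
      have : x⁻¹ * y = u * ((x • u)⁻¹ * y) := by
        simp only [smul_eq_mul]
        group
      rw [this]
      exact U.mul_mem hu (hNU h)
  infer_instance

end Quotient

/-! ### `Out(G)` as a profinite group -/

section Out

variable {G : Type u} [Group G] [TopologicalSpace G] [IsTopologicalGroup G] [CompactSpace G]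
  [TotallyDisconnectedSpace G] (hG : IsTopologicallyFinitelyGenerated G)

/-- The image of the inner automorphisms in `profiniteAut hG` (closed, normal).
[cite: MochizukiSemiAnbd2006, §0 p.5] -/
noncomputable abbrev innProfinite : Subgroup (profiniteAut hG) := (conjProfiniteAut hG).toMonoidHom.range

/-- **`Out(G)` as a profinite group**: `profiniteAut hG ⧸ Inn(G)` (quotient by a CLOSED normal subgroup of
a profinite group: compact, Hausdorff, totally disconnected). [cite: MochizukiSemiAnbd2006, §0 p.5] -/
noncomputable def outProfinite : ProfiniteGrp.{u} :=
  haveI : (innProfinite hG).Normal := range_conjProfiniteAut_normal hG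
  haveI : IsClosed ((innProfinite hG : Subgroup (profiniteAut hG)) : Set (profiniteAut hG)) :=
    isClosed_range_conjProfiniteAut hG
  haveI : TotallyDisconnectedSpace (profiniteAut hG ⧸ innProfinite hG) :=
    totallyDisconnectedSpace_quotient_of_isClosed _ (isClosed_range_conjProfiniteAut hG)
  ProfiniteGrp.of (profiniteAut hG ⧸ innProfinite hG)

/-- **The projection `Aut(G) → Out(G)`** as a continuous homomorphism of profinite groups.
[cite: MochizukiSemiAnbd2006, §0 p.5] -/
noncomputable def outProj : profiniteAut hG →ₜ* outProfinite hG :=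
  haveI : (innProfinite hG).Normal := range_conjProfiniteAut_normal hG
  ⟨QuotientGroup.mk' (innProfinite hG), QuotientGroup.continuous_mk⟩

/-- `outProj` is the quotient map. [cite: MochizukiSemiAnbd2006, §0 p.5] -/
theorem outProj_apply (a : profiniteAut hG) :
    outProj hG a = (QuotientGroup.mk a : profiniteAut hG ⧸ innProfinite hG) := rfl

/-- `outProj` is surjective. [cite: MochizukiSemiAnbd2006, §0 p.5] -/
theorem outProj_surjective : Function.Surjective (outProj hG) := by
  intro o
  obtain ⟨a, rfl⟩ := QuotientGroup.mk_surjective o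
  exact ⟨a, rfl⟩

/-- **The kernel of `Aut(G) → Out(G)` is `Inn(G)`** (the image of `G`). [cite: MochizukiSemiAnbd2006, §0 p.5] -/
theorem outProj_eq_one_iff (a : profiniteAut hG) : outProj hG a = 1 ↔ a ∈ innProfinite hG := by
  haveI : (innProfinite hG).Normal := range_conjProfiniteAut_normal hG
  rw [outProj_apply]
  exact QuotientGroup.eq_one_iff a

/-- `outProj (conj g) = 1`. [cite: MochizukiSemiAnbd2006, §0 p.5] -/
@[simp] theorem outProj_conjProfiniteAut (g : G) : outProj hG (conjProfiniteAut hG g) = 1 :=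
  (outProj_eq_one_iff hG _).mpr ⟨g, rfl⟩

end Out

/-! ### The outer semi-direct product `G ⋊^out J` of profinite groups -/

section Semidirect

variable {G : Type u} [Group G] [TopologicalSpace G] [IsTopologicalGroup G] [CompactSpace G]
  [TotallyDisconnectedSpace G] (hG : IsTopologicallyFinitelyGenerated G)
  {J : Type u} [Group J] [TopologicalSpace J] (θ : J →ₜ* outProfinite hG)

/-- **The fibre product `Aut(G) ×_{Out(G)} J`** as a subgroup of `profiniteAut hG × J`: the equaliser of
`Aut(G) × J → Out(G)` (via the projection) and `Aut(G) × J → Out(G)` (via `θ`).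
[cite: MochizukiSemiAnbd2006, §0 p.5] -/
noncomputable def outerSemidirectSubgroup : Subgroup (profiniteAut hG × J) :=
  MonoidHom.eqLocus ((outProj hG).toMonoidHom.comp (MonoidHom.fst _ _))
    (θ.toMonoidHom.comp (MonoidHom.snd _ _))

/-- Membership in the fibre product. [cite: MochizukiSemiAnbd2006, §0 p.5] -/
theorem mem_outerSemidirectSubgroup_iff {p : profiniteAut hG × J} :
    p ∈ outerSemidirectSubgroup hG θ ↔ outProj hG p.1 = θ p.2 := Iff.rfl

/-- The fibre product is CLOSED (an equaliser of continuous maps into the Hausdorff `Out(G)`).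
[cite: MochizukiSemiAnbd2006, §0 p.5] -/
theorem isClosed_outerSemidirectSubgroup :
    IsClosed (outerSemidirectSubgroup hG θ : Set (profiniteAut hG × J)) :=
  isClosed_eq ((outProj hG).continuous.comp continuous_fst) (θ.continuous.comp continuous_snd)

variable [IsTopologicalGroup J] [CompactSpace J] [TotallyDisconnectedSpace J]

/-- **`G ⋊^out J` as a profinite group** (`J` profinite, `θ : J → Out(G)` continuous): the closed
subgroup `Aut(G) ×_{Out(G)} J` of the profinite group `profiniteAut hG × J`.
[cite: MochizukiSemiAnbd2006, §0 p.5] -/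
noncomputable def outerSemidirectProfinite : ProfiniteGrp.{u} :=
  haveI : CompactSpace (outerSemidirectSubgroup hG θ) :=
    isCompact_iff_compactSpace.mp (isClosed_outerSemidirectSubgroup hG θ).isCompact
  ProfiniteGrp.of (outerSemidirectSubgroup hG θ)

/-- **`G → G ⋊^out J`**, `g ↦ (conj g, 1)`, as a continuous homomorphism. [cite: MochizukiSemiAnbd2006, §0 p.5] -/
noncomputable def inlProfinite : G →ₜ* outerSemidirectProfinite hG θ where
  toFun g := ⟨(conjProfiniteAut hG g, 1), by
    rw [mem_outerSemidirectSubgroup_iff, outProj_conjProfiniteAut, map_one]⟩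
  map_one' := Subtype.ext (Prod.ext (map_one _) rfl)
  map_mul' g h := Subtype.ext (Prod.ext (map_mul _ g h) (mul_one _).symm)
  continuous_toFun := by
    refine Continuous.subtype_mk ?_ _
    exact (conjProfiniteAut hG).continuous.prodMk continuous_const

/-- Components of `inlProfinite`. [cite: MochizukiSemiAnbd2006, §0 p.5] -/
@[simp] theorem inlProfinite_apply (g : G) :
    ((inlProfinite hG θ g).1 : profiniteAut hG × J) = (conjProfiniteAut hG g, 1) := rfl

/-- **`G ⋊^out J → J`** as a continuous homomorphism. [cite: MochizukiSemiAnbd2006, §0 p.5] -/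
noncomputable def sndProfinite : outerSemidirectProfinite hG θ →ₜ* J where
  toMonoidHom := (MonoidHom.snd (profiniteAut hG) J).comp (outerSemidirectSubgroup hG θ).subtype
  continuous_toFun := continuous_snd.comp continuous_subtype_val

/-- `sndProfinite` is the second projection. [cite: MochizukiSemiAnbd2006, §0 p.5] -/
@[simp] theorem sndProfinite_apply (p : outerSemidirectProfinite hG θ) : sndProfinite hG θ p = p.1.2 := rfl

/-- **`G ⋊^out J → J` is surjective** (`Aut(G) → Out(G)` is). [cite: MochizukiSemiAnbd2006, §0 p.5] -/
theorem sndProfinite_surjective : Function.Surjective (sndProfinite hG θ) := by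
  intro j
  obtain ⟨a, ha⟩ := outProj_surjective hG (θ j)
  exact ⟨⟨(a, j), ha⟩, rfl⟩

/-- `snd ∘ inl = 1`. [cite: MochizukiSemiAnbd2006, §0 p.5] -/
@[simp] theorem sndProfinite_inlProfinite (g : G) : sndProfinite hG θ (inlProfinite hG θ g) = 1 := rfl

/-- **Exactness in the middle: `range (G → G ⋊^out J) = ker (G ⋊^out J → J)`.**
[cite: MochizukiSemiAnbd2006, §0 p.5] -/
theorem range_inlProfinite_eq_ker :
    (inlProfinite hG θ).toMonoidHom.range = (sndProfinite hG θ).toMonoidHom.ker := by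
  ext p
  constructor
  · rintro ⟨g, rfl⟩
    rfl
  · intro hp
    rw [MonoidHom.mem_ker] at hp
    change p.1.2 = 1 at hp
    have hmem := p.2
    rw [mem_outerSemidirectSubgroup_iff, hp, map_one, outProj_eq_one_iff] at hmem
    obtain ⟨g, hg⟩ := hmem
    refine ⟨g, Subtype.ext (Prod.ext hg ?_)⟩
    change (1 : J) = p.1.2
    rw [hp]

/-- **`G → G ⋊^out J` is injective for centre-free `G`.** [cite: MochizukiSemiAnbd2006, §0 p.5] -/
theorem inlProfinite_injective (hZ : Subgroup.center G = ⊥) : Function.Injective (inlProfinite hG θ) := by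
  intro g h hgh
  have := congrArg (fun p : outerSemidirectProfinite hG θ => p.1.1) hgh
  exact conjProfiniteAut_injective hG hZ this

/-- **The image of `G` in `G ⋊^out J` is closed** (and normal, being a kernel), so that
`(G ⋊^out J, image of G)` is a `ProfiniteGrp` with a closed normal subgroup — the shape of
[AbsTopII] Def 1.2 (ii) `Π_𝔾 ⊆ Π_H`. [cite: MochizukiSemiAnbd2006, §0 p.5] -/
theorem isClosed_range_inlProfinite :
    IsClosed ((inlProfinite hG θ).toMonoidHom.range : Set (outerSemidirectProfinite hG θ)) := by
  have : ((inlProfinite hG θ).toMonoidHom.range : Set (outerSemidirectProfinite hG θ)) =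
      Set.range (inlProfinite hG θ) := by
    ext x; simp
  rw [this]
  exact (isCompact_range (inlProfinite hG θ).continuous).isClosed

/-- The image of `G` in `G ⋊^out J` is normal. [cite: MochizukiSemiAnbd2006, §0 p.5] -/
theorem range_inlProfinite_normal : (inlProfinite hG θ).toMonoidHom.range.Normal := by
  rw [range_inlProfinite_eq_ker]
  infer_instance

/-- **`G → G ⋊^out J` is a CLOSED EMBEDDING for centre-free `G`** (a continuous injection from a compact
space to a Hausdorff space): the topological half of the exactness at `G`. [cite: MochizukiSemiAnbd2006, §0 p.5] -/
theorem isClosedEmbedding_inlProfinite (hZ : Subgroup.center G = ⊥) :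
    Topology.IsClosedEmbedding (inlProfinite hG θ) :=
  (inlProfinite hG θ).continuous.isClosedEmbedding (inlProfinite_injective hG θ hZ)

/-- **`G ⋊^out J → J` is an OPEN quotient map** (a continuous surjective homomorphism between profinite —
in particular compact Hausdorff — groups; open by the open mapping theorem for compact groups, here via
`MonoidHom.isOpenMap_of_sigmaCompact`). [cite: MochizukiSemiAnbd2006, §0 p.5] -/
theorem isOpenMap_sndProfinite : IsOpenMap (sndProfinite hG θ) :=
  MonoidHom.isOpenMap_of_sigmaCompact (sndProfinite hG θ).toMonoidHom (sndProfinite_surjective hG θ)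
    (sndProfinite hG θ).continuous

end Semidirect


/-! ### Comparison with the algebraic outer semi-direct product `SemiGraphs.outerSemidirectProduct` -/

section Compare

variable {G : Type u} [Group G] [TopologicalSpace G] [IsTopologicalGroup G] [CompactSpace G]
  [TotallyDisconnectedSpace G] (hG : IsTopologicallyFinitelyGenerated G)

/-- **`Out(G)` (the tree's algebraic `EtaleTheta.TopOut G`) ≃ `outProfinite hG`**, induced by
`profiniteAutEquiv : Aut(G) ≃ profiniteAut hG` (which carries `Inn(G)` onto the image of `G`).
[cite: MochizukiSemiAnbd2006, §0 p.5] -/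
noncomputable def outEquiv : TopOut G ≃* outProfinite hG :=
  haveI : (innProfinite hG).Normal := range_conjProfiniteAut_normal hG
  QuotientGroup.congr (innerContAut G) (innProfinite hG) (profiniteAutEquiv (hG := hG))
    (range_conjProfiniteAut hG).symm

/-- `outEquiv` on classes: the class of `φ` goes to the class of `profiniteAutEquiv φ`.
[cite: MochizukiSemiAnbd2006, §0 p.5] -/
theorem outEquiv_mk (φ : contMulAut G) :
    outEquiv hG (TopOut.mk G φ) = outProj hG (profiniteAutEquiv (hG := hG) φ) := by
  haveI : (innProfinite hG).Normal := range_conjProfiniteAut_normal hG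
  exact QuotientGroup.congr_mk (innerContAut G) (innProfinite hG) (profiniteAutEquiv (hG := hG))
    (range_conjProfiniteAut hG).symm φ

variable {J : Type u} [Group J] [TopologicalSpace J] (θ : J →ₜ* outProfinite hG)

/-- The algebraic outer action `J → TopOut G` underlying a continuous `θ : J → outProfinite hG`.
[cite: MochizukiSemiAnbd2006, §0 p.5] -/
noncomputable def outerActionOfContinuous : J →* TopOut G :=
  (outEquiv hG).symm.toMonoidHom.comp θ.toMonoidHom

/-- Defining relation of `outerActionOfContinuous`. [cite: MochizukiSemiAnbd2006, §0 p.5] -/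
theorem outEquiv_outerActionOfContinuous (j : J) :
    outEquiv hG (outerActionOfContinuous hG θ j) = θ j := by
  change outEquiv hG ((outEquiv hG).symm (θ j)) = θ j
  exact (outEquiv hG).apply_symm_apply _

/-- **The profinite `G ⋊^out J` IS the algebraic outer semi-direct product** `outerSemidirectProduct ρ`
of the tree (abc-iut-L3, `NotationsConventions.lean`) for `ρ := outerActionOfContinuous hG θ`,
transported along `profiniteAutEquiv` on the `Aut`-factor. [cite: MochizukiSemiAnbd2006, §0 p.5] -/
noncomputable def outerSemidirectProfiniteEquiv :
    outerSemidirectSubgroup hG θ ≃* outerSemidirectProduct (outerActionOfContinuous hG θ) where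
  toFun p := ⟨((profiniteAutEquiv (hG := hG)).symm p.1.1, p.1.2), by
    change TopOut.mk G ((profiniteAutEquiv (hG := hG)).symm p.1.1) = outerActionOfContinuous hG θ p.1.2
    apply (outEquiv hG).injective
    rw [outEquiv_mk, MulEquiv.apply_symm_apply, outEquiv_outerActionOfContinuous]
    exact p.2⟩
  invFun q := ⟨(profiniteAutEquiv (hG := hG) q.1.1, q.1.2), by
    rw [mem_outerSemidirectSubgroup_iff]
    change outProj hG (profiniteAutEquiv (hG := hG) q.1.1) = θ q.1.2
    rw [← outEquiv_mk, q.2, outEquiv_outerActionOfContinuous]⟩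
  left_inv p := by
    apply Subtype.ext
    exact Prod.ext ((profiniteAutEquiv (hG := hG)).apply_symm_apply _) rfl
  right_inv q := by
    apply Subtype.ext
    exact Prod.ext ((profiniteAutEquiv (hG := hG)).symm_apply_apply _) rfl
  map_mul' p q := by
    apply Subtype.ext
    exact Prod.ext (map_mul _ _ _) rfl

/-- The comparison isomorphism commutes with the two maps from `G`: `(conj g, 1) ↦ (conj g, 1)`.
[cite: MochizukiSemiAnbd2006, §0 p.5] -/
theorem outerSemidirectProfiniteEquiv_inl [IsTopologicalGroup J] [CompactSpace J] [TotallyDisconnectedSpace J]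
    (g : G) :
    outerSemidirectProfiniteEquiv hG θ (inlProfinite hG θ g) =
      toOuterSemidirectProduct (outerActionOfContinuous hG θ) g := by
  apply Subtype.ext
  refine Prod.ext ?_ rfl
  change (profiniteAutEquiv (hG := hG)).symm (conjProfiniteAut hG g) = _
  rw [MulEquiv.symm_apply_eq]
  rfl

/-- The comparison isomorphism commutes with the two projections to `J`. [cite: MochizukiSemiAnbd2006, §0 p.5] -/
theorem outerSemidirectProductSnd_outerSemidirectProfiniteEquiv [IsTopologicalGroup J] [CompactSpace J]
    [TotallyDisconnectedSpace J] (p : outerSemidirectProfinite hG θ) :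
    outerSemidirectProductSnd (outerActionOfContinuous hG θ) (outerSemidirectProfiniteEquiv hG θ p) =
      sndProfinite hG θ p := rfl

end Compare

end Literature.AnabelianGeometry.AbsoluteAnabelian
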